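import Literature.NumberTheory.EllipticCurves.HeegnerPointsKolyvaginLocalCriterion
import Literature.NumberTheory.EllipticCurves.HeegnerPointsKolyvaginPrimaryEigenProofs
import Summits.BirchSwinnertonDyer.BirchSwinnertonDyer.Theorems.GenusKolyvaginAtTwoEquivariantKolyvaginExactAtTwoDescent
import HarnessLib

/-!
# Route `GenusKolyvaginAtTwo`, LINE 6, KEY crux Q3 `EquivariantKolyvaginExactAtTwo`
# (stmt-BirchSwinnertonDyer-24882): the local criterion at a Frobenius that does NOT fix `E[n]`,
# and McCallum's Lemma 5.3 over `ℚ_ℓ` at `p = 2` WITHOUT DEFECT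

Helper (seat `bsd-line-gk2-p3` g11, cell `bsd-f1-sign2`; `--supports` the item, closes nothing). The
eigen/`ℚ` architecture of Q3 (memo `Q3-KERNEL-EIGEN-v2`: McCallum §5 at `2` run OVER `ℚ` for `E` and its
twin) needs, at a Kolyvagin prime `ℓ`, the strict local condition `x_ℓ = 0` and the ORDER of `x_ℓ` for a
class `x ∈ H¹(ℚ, E[2^M])` in terms of the value `[x, Frob_ℓ]`. The tree's criterion (Gross 1991,
Prop. 9.6: `HeegnerPointsKolyvaginLocalCriterion.mem_torsionLocalKer_iff_h1Eval_eq_zero`) assumes the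
Frobenius FIXES `E[n]` — true over `K_λ` (`Frob_λ = Frob_ℓ²`), false over `ℚ_ℓ`, where `Frob_ℓ` acts on
`E[2^M]` as complex conjugation (Gross (3.2)), i.e. (on `Δ < 0`, Q1 `CyclicTorsionOfNegDisc`) through
the REGULAR representation `R_M = ℤ/2^M[F]`.

* §1 (any number field `K`, any `W/K`, any `n`, any finite place; `F` an arithmetic Frobenius at the
  prime `𝔓` cut out by the chosen embedding, NOT assumed to fix `E[n]`; inertia acting trivially;
  `x` unramified at `𝔓`): **`x ∈ torsionLocalKer ⟺ [x, F] ∈ (F − 1)·E[n]`**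
  (`mem_torsionLocalKer_iff_exists_h1Eval_eq_smul_sub`) — `H¹(Ẑ, T) = T/(F − 1)T`; Prop. 9.6 is the
  case `(F − 1)T = 0`. Also: the value `[x, F]` of the CHOSEN cocycle is well defined exactly modulo
  `(F − 1)T` (`exists_h1Eval_zsmul_eq`).
* §2 (`F` acting on `T = E[n]` as an involution with `T` free of rank one over `ℤ/2^M[F]` on `P`):
  **`c·x ∈ torsionLocalKer ⟺ c·N[x, F] = 0`**, `N = 1 + F` (`zsmul_mem_torsionLocalKer_iff_norm`): the
  local order of `x` is the order of the NORM of `[x, F]` (`Ĥ⁻¹(C₂, R_M) = 0`, this lineage's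
  `Gorenstein.exists_eq_sub_tau_of_norm_eq_zero`).
* §3 (pure algebra, McCallum's Lemma 5.3 over `ℚ_ℓ` at `2`): for `T` free on `{P, FP}` with `2^M P = 0`,
  an alternating left-non-degenerate `e` on `T`, `u ∈ T` ARBITRARY and a tame value `t` with `Ft = −t`:
  **`2^a t ≠ 0 ∧ e(u, t) = 0 ⟹ 2^{M−1−a}·N u = 0`** (`pow_zsmul_norm_eq_zero_of_pairing_eq_zero`) — the
  printed exponent `M − 1 − a`, NO DEFECT; contrast: over `K_λ` the class is `Nu` itself and
  `e(Nu, t) = 2e(u, t)` loses one bit (`Gorenstein.pairing_norm_norm`, and the CM analogue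
  `SylvesterTwoUpper…pow_nsmul_eq_zero_of_pairing_eigen_two` with exponent `M − a`). The twin `E^K`
  needs no separate form: `Frob_ℓ` acts on `E^K[2^M]` again as a complex conjugation
  (`…TwinGrossPrimes.frobEqFrobInfty_of_smul_quadraticTwist_eq`), so the same statements apply to it.
* §4 = §1 + §2 + §3: **`pow_zsmul_mem_torsionLocalKer_of_pairing_eq_zero`** — if `e([x, F], t) = 0` for a
  tame value `t ∈ T^{F = −1}` with `2^a t ≠ 0`, then `2^{M−1−a} x ∈ torsionLocalKer`: the `duality`
  field of `KolyvaginDescent.SplitHypothesesM` (gk2-p2, S7) over `ℚ_ℓ` in torsion-module form, given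
  the reciprocity value.

Everything is PROVED (no definition, no named fact, no `sorry`, standard axioms). BSD is not proved by
any of this; it is local infrastructure for the crux's stubs S3/S6.

References: [GrossLMS1991] §3 (3.2), §9 Prop. 9.6; [McCallumLMS1991] §3 (3), §5 Lemma 5.3;
[NeukirchANT1999] I §9 (9.4), II §9 (9.6).
-/

set_option autoImplicit false
set_option linter.dupNamespace false -- tree convention: `Summit.BirchSwinnertonDyer.BirchSwinnertonDyer.Theorems` (summit = sub-problem)

noncomputable section

open scoped Classical Pointwise

namespace Summit.BirchSwinnertonDyer.BirchSwinnertonDyer.Theorems.GenusExact.FrobeniusCriterion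

open WeierstrassCurve NumberField IsDedekindDomain Field
open Literature.NumberTheory.EllipticCurves Literature.NumberTheory.GaloisRepresentations
open Summit.BirchSwinnertonDyer.BirchSwinnertonDyer.Theorems.GenusExact.Gorenstein

universe u

variable {K : Type u} [Field K] [NumberField K] {v : HeightOneSpectrum (𝓞 K)} (W : WeierstrassCurve K)

/-! ## §1 The local criterion at a Frobenius that need not fix `E[n]` -/

section Criterion

omit [NumberField K] in
/-- **Cocycle identity for the chosen cocycle**: `[x, ρρ′] = [x, ρ] + ρ·[x, ρ′]` (no hypothesis on
`ρ`). [folklore] -/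
theorem h1Eval_mul_smul (n : ℤ) (x : galH1Torsion W n) (ρ ρ' : absoluteGaloisGroup K) :
    h1Eval W n x (ρ * ρ') = h1Eval W n x ρ + ρ • h1Eval W n x ρ' := by
  have h := (reprCocycle W n x).2 ρ ρ'
  rw [discreteTopRep_ρ_apply] at h
  exact h

omit [NumberField K] in
/-- **`[x, ρ^k] = ρ^k·P − P` as soon as `[x, ρ] = ρ·P − P`** (telescoping the cocycle identity).
[folklore] -/
theorem h1Eval_pow_eq_smul_sub (n : ℤ) (x : galH1Torsion W n) {ρ : absoluteGaloisGroup K}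
    {P : geomTorsion W n} (h : h1Eval W n x ρ = ρ • P - P) (k : ℕ) :
    h1Eval W n x (ρ ^ k) = ρ ^ k • P - P := by
  induction k with
  | zero => rw [pow_zero, h1Eval_one, one_smul, sub_self]
  | succ k ih =>
    rw [pow_succ, h1Eval_mul_smul, ih, h, smul_sub, ← mul_smul, ← pow_succ]
    abel

omit [NumberField K] in
/-- **The chosen cocycle of `c • x` at `ρ` differs from `c·[x, ρ]` by a coboundary value
`ρ·b − b`** (cohomologous cocycles; at `ρ ∈ Γ_{K(E[n])}` this is the tree's `h1Eval_zsmul`).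
[folklore] -/
theorem exists_h1Eval_zsmul_eq (n : ℤ) (x : galH1Torsion W n) (c : ℤ) (ρ : absoluteGaloisGroup K) :
    ∃ b : geomTorsion W n, h1Eval W n (c • x) ρ = c • h1Eval W n x ρ + (ρ • b - b) := by
  have h1 : oneCocycleClass _ (c • reprCocycle W n x) = c • x := by
    change oneCocycleClassₗ _ (c • reprCocycle W n x) = _
    rw [map_zsmul, oneCocycleClassₗ_apply, oneCocycleClass_reprCocycle]
  have h0 : oneCocycleClass _ (reprCocycle W n (c • x) - c • reprCocycle W n x) = 0 := by
    rw [oneCocycleClass_sub, h1, oneCocycleClass_reprCocycle, sub_self]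
  obtain ⟨b, hb⟩ := (oneCocycleClass_eq_zero_iff _ _).mp h0
  refine ⟨b, ?_⟩
  have h := hb ρ
  rw [discreteTopRep_ρ_apply] at h
  change h1Eval W n (c • x) ρ - c • h1Eval W n x ρ = ρ • b - b at h
  rw [← h]
  abel

/-- **The local criterion at an arbitrary Frobenius** (Gross 1991, Prop. 9.6 without "`λ` splits in
`K(E_p)`"; McCallum §3 (3) with Neukirch I (9.4)): at a finite place `v` of `K`, with `𝔓` the prime of
`\bar ℤ_K` cut out by the chosen embedding `K̄ → K̄_v` and `F ∈ Γ_K` an arithmetic Frobenius at `𝔓`,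
the inertia group `I_𝔓` acting trivially on `E[n]`, `Γ_{K(E[n])}` open, `E(K̄)[n] → E(K̄_v)[n]` onto, and
`x ∈ H¹(K, E[n])` unramified at `𝔓`: **`x_v = 0 ⟺ [x, F] = F·P − P` for some `P ∈ E[n]`** — the
restriction of `x` to the decomposition group is inflated from the procyclic `G_𝔓/I_𝔓 = ⟨F⟩`, and
`H¹(⟨F⟩, T) = T/(F − 1)T`. (⟹) lift `F` to `Γ_{K_v}`; (⟸) with `[x, F] = F·P − P` the cocycle of `x`
agrees with the coboundary of `P` on `F^k·i·u` (`i ∈ I_𝔓`, `u` small), i.e. on `G_𝔓 ⊇ res Γ_{K_v}`.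
[cite: GrossLMS1991, Prop. 9.6] [cite: McCallumLMS1991, §3 (3)] [cite: NeukirchANT1999, I §9 (9.4)] -/
theorem mem_torsionLocalKer_iff_exists_h1Eval_eq_smul_sub (n : ℤ)
    {𝔐 : Ideal (HeightOneSpectrum.localAbsIntegers v)} (h𝔐 : 𝔐 ∈ v.localPrimesAbove)
    {F : absoluteGaloisGroup K}
    (hF : IsArithFrobAt (𝓞 K) F (v.primeBelow (closureEmb (K := K) (v.adicCompletion K)) 𝔐))
    (hI : (v.primeBelow (closureEmb (K := K) (v.adicCompletion K)) 𝔐).inertia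
      (absoluteGaloisGroup K) ≤ torsionFixing W n)
    (hopen : IsOpen (torsionFixing W n : Set (absoluteGaloisGroup K)))
    (hsurj : Function.Surjective (torsionPointsMap W (v.adicCompletion K) n))
    {x : galH1Torsion W n}
    (hx : x ∈ unramifiedKer (geomTorsion W n)
      (v.primeBelow (closureEmb (K := K) (v.adicCompletion K)) 𝔐)) :
    x ∈ W.torsionLocalKer (v.adicCompletion K) n ↔
      ∃ P : geomTorsion W n, h1Eval W n x F = F • P - P := by
  set ι₀ := closureEmb (K := K) (v.adicCompletion K) with hι₀
  set 𝔓 := v.primeBelow ι₀ 𝔐 with h𝔓def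
  have h𝔓 : 𝔓 ∈ v.primesAbove := HeightOneSpectrum.primeBelow_mem_primesAbove h𝔐
  haveI : 𝔓.IsPrime := h𝔓.1
  set φ := reprCocycle W n x with hφ
  have hclass : oneCocycleClass _ φ = x := oneCocycleClass_reprCocycle W n x
  have hinj := torsionPointsMap_injective W (v.adicCompletion K) n
  have hker : x ∈ W.torsionLocalKer (v.adicCompletion K) n ↔
      ∃ Q : AddSubgroup.torsionBy (localPoints W (v.adicCompletion K)) n,
        ∀ g : absoluteGaloisGroup (v.adicCompletion K),
          torsionPointsMap W (v.adicCompletion K) n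
            (φ.1 (resGal (K := K) (v.adicCompletion K) g)) = g • Q - Q := by
    rw [← hclass]
    exact oneCocycleClass_mem_resKer_iff _ _ _ φ
  -- `φ` vanishes on the inertia group (unramified, inertia acting trivially)
  have hφI : ∀ i ∈ 𝔓.inertia (absoluteGaloisGroup K), φ.1 i = 0 := by
    have hx' : oneCocycleClass _ φ ∈ unramifiedKer (geomTorsion W n) 𝔓 := by rwa [hclass]
    obtain ⟨a, ha⟩ := (oneCocycleClass_mem_subgroupResKer_iff _ φ).mp hx'
    intro i hi
    rw [ha ⟨i, hi⟩, Subgroup.coe_mk, smul_eq_of_mem_torsionFixing W n (hI hi), sub_self]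
  constructor
  · -- `x_v = 0 ⟹ [x, F] = F·P − P`: lift `F` to `Γ_{K_v}` and read the coboundary there
    intro hloc
    obtain ⟨Q, hQ⟩ := hker.mp hloc
    obtain ⟨P, rfl⟩ := hsurj Q
    obtain ⟨σ, hσ⟩ :=
      exists_apply_eq_smul_of_mem_decompositionSubgroup ι₀ h𝔐 hF.mem_stabilizer
    have hres : resGal (K := K) (v.adicCompletion K) σ = F := by
      rw [resGal_eq]; exact resGalOfEmb_eq_of_apply_eq ι₀ hσ
    refine ⟨P, hinj ?_⟩
    have h := hQ σ
    rw [hres, ← torsionPointsMap_smul, hres, ← map_sub] at h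
    exact h
  · -- `[x, F] = F·P − P ⟹ x_v = 0`: `φ` is the coboundary of `P` on `G_𝔓 ⊇ res(Γ_{K_v})`
    rintro ⟨P, hP⟩
    refine hker.mpr ⟨torsionPointsMap W (v.adicCompletion K) n P, fun g ↦ ?_⟩
    rw [← torsionPointsMap_smul, ← map_sub]
    congr 1
    have hd : resGal (K := K) (v.adicCompletion K) g ∈
        𝔓.decompositionSubgroup (absoluteGaloisGroup K) := by
      rw [resGal_eq]; exact resGalOfEmb_mem_decompositionSubgroup ι₀ h𝔐 g
    obtain ⟨k, i, u, hi, hu, hdec⟩ :=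
      exists_eq_frobenius_pow_mul_of_mem_decompositionSubgroup h𝔓 hF
        (isOpen_evalKer W n (fun _ : Unit ↦ x) hopen) hd
    have hui : u ∈ torsionFixing W n := hu.1
    change φ.1 (resGal (K := K) (v.adicCompletion K) g) = _
    rw [hdec]
    have h1 : φ.1 (F ^ k * i * u) = φ.1 (F ^ k) + F ^ k • (φ.1 i + i • φ.1 u) := by
      change h1Eval W n x (F ^ k * i * u) =
        h1Eval W n x (F ^ k) + F ^ k • (h1Eval W n x i + i • h1Eval W n x u)
      rw [h1Eval_mul_smul, h1Eval_mul_smul, mul_smul, smul_add, add_assoc]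
    have hφu : φ.1 u = 0 := hu.2 ()
    have hφFk : φ.1 (F ^ k) = F ^ k • P - P := h1Eval_pow_eq_smul_sub W n x hP k
    rw [h1, hφI i hi, hφu, smul_zero, add_zero, smul_zero, add_zero, hφFk, mul_smul, mul_smul,
      smul_eq_of_mem_torsionFixing W n hui, smul_eq_of_mem_torsionFixing W n (hI hi)]

end Criterion

/-! ## §2 Regular involutions: the local order is the order of the norm of `[x, F]` -/

section Regular

variable {n : ℤ} {F : absoluteGaloisGroup K} {M : ℕ} {P : geomTorsion W n}

omit [NumberField K] in
/-- **`u ∈ (F − 1)T ⟺ N u = 0` for `T = E[n]` free of rank one over `ℤ/2^M[F]`** (`F` an involution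
on `T`, `T = ℤP ⊕ ℤFP` with `2^M P = 0` and no smaller relations): `Ĥ⁻¹(C₂, R_M) = 0`, this lineage's
`Gorenstein.exists_eq_sub_tau_of_norm_eq_zero`; the converse is `F² = 1`.
[cite: McCallumLMS1991, §3 (restriction to L is injective)] -/
theorem exists_eq_smul_sub_iff_norm_eq_zero (hF : ∀ Q : geomTorsion W n, F • F • Q = Q)
    (hPM : (2 : ℤ) ^ M • P = 0) (hgen : ∀ Q : geomTorsion W n, ∃ x y : ℤ, Q = x • P + y • F • P)
    (hfree : ∀ x y : ℤ, x • P + y • F • P = 0 → (2 : ℤ) ^ M ∣ x ∧ (2 : ℤ) ^ M ∣ y)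
    (u : geomTorsion W n) : (∃ Q : geomTorsion W n, u = F • Q - Q) ↔ u + F • u = 0 := by
  constructor
  · rintro ⟨Q, rfl⟩
    rw [smul_sub, hF, sub_add_sub_cancel', sub_self]
  · intro hu
    -- the action of `F` as an additive endomorphism, to feed this lineage's `R_M`-algebra
    set τF : geomTorsion W n →+ geomTorsion W n := DistribSMul.toAddMonoidHom (geomTorsion W n) F
      with hτF
    have hτFa : ∀ a, τF a = F • a := fun a ↦ rfl
    have hA : ∀ a, τF (τF a) = a := fun a ↦ by rw [hτFa, hτFa]; exact hF a
    have hgen' : ∀ a, ∃ x y : ℤ, a = x • P + y • τF P := fun a ↦ by rw [hτFa]; exact hgen a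
    have hfree' : ∀ x y : ℤ, x • P + y • τF P = 0 → (2 : ℤ) ^ M ∣ x ∧ (2 : ℤ) ^ M ∣ y :=
      fun x y h ↦ hfree x y (by rw [hτFa] at h; exact h)
    have hu' : u + τF u = 0 := by rw [hτFa]; exact hu
    obtain ⟨b, hb⟩ := exists_eq_sub_tau_of_norm_eq_zero τF hA hPM hgen' hfree' hu'
    refine ⟨-b, ?_⟩
    rw [hb, hτFa, smul_neg]
    abel

/-- **The local order of an unramified class at a regular Frobenius is the order of the NORM of its
Frobenius value: `c·x ∈ torsionLocalKer ⟺ c·([x, F] + F[x, F]) = 0`** (`x_v`'s order equals the order of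
`N[x, F] ∈ T^{F}`, a cyclic group of order `2^M`). Hypotheses: those of §1 plus "`F` acts on `E[n]` as an
involution with `E[n]` free of rank one over `ℤ/2^M[F]`" (on `Δ(E) < 0` at a Gross–Kolyvagin prime of
depth `M` with `n = 2^M`: Q1 `CyclicTorsionOfNegDisc` and Gross (3.2)). [cite: McCallumLMS1991, §3 (3) and §5 Lemma 5.3]
[cite: GrossLMS1991, Prop. 9.6] -/
theorem zsmul_mem_torsionLocalKer_iff_norm
    {𝔐 : Ideal (HeightOneSpectrum.localAbsIntegers v)} (h𝔐 : 𝔐 ∈ v.localPrimesAbove)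
    (hFrob : IsArithFrobAt (𝓞 K) F (v.primeBelow (closureEmb (K := K) (v.adicCompletion K)) 𝔐))
    (hI : (v.primeBelow (closureEmb (K := K) (v.adicCompletion K)) 𝔐).inertia
      (absoluteGaloisGroup K) ≤ torsionFixing W n)
    (hopen : IsOpen (torsionFixing W n : Set (absoluteGaloisGroup K)))
    (hsurj : Function.Surjective (torsionPointsMap W (v.adicCompletion K) n))
    (hF : ∀ Q : geomTorsion W n, F • F • Q = Q)
    (hPM : (2 : ℤ) ^ M • P = 0) (hgen : ∀ Q : geomTorsion W n, ∃ x y : ℤ, Q = x • P + y • F • P)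
    (hfree : ∀ x y : ℤ, x • P + y • F • P = 0 → (2 : ℤ) ^ M ∣ x ∧ (2 : ℤ) ^ M ∣ y)
    {x : galH1Torsion W n}
    (hx : x ∈ unramifiedKer (geomTorsion W n)
      (v.primeBelow (closureEmb (K := K) (v.adicCompletion K)) 𝔐)) (c : ℤ) :
    c • x ∈ W.torsionLocalKer (v.adicCompletion K) n ↔
      c • (h1Eval W n x F + F • h1Eval W n x F) = 0 := by
  have hcx : c • x ∈ unramifiedKer (geomTorsion W n)
      (v.primeBelow (closureEmb (K := K) (v.adicCompletion K)) 𝔐) :=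
    (unramifiedKer (geomTorsion W n) _).zsmul_mem hx c
  rw [mem_torsionLocalKer_iff_exists_h1Eval_eq_smul_sub W n h𝔐 hFrob hI hopen hsurj hcx]
  obtain ⟨b, hb⟩ := exists_h1Eval_zsmul_eq W n x c F
  -- `[cx, F] = c[x,F] + (Fb − b)`: both sides are statements "modulo `(F − 1)T`"
  have hiff : (∃ Q : geomTorsion W n, h1Eval W n (c • x) F = F • Q - Q) ↔
      ∃ Q : geomTorsion W n, c • h1Eval W n x F = F • Q - Q := by
    rw [hb]
    constructor
    · rintro ⟨Q, hQ⟩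
      exact ⟨Q - b, by rw [smul_sub]; linear_combination (norm := abel_nf) hQ⟩
    · rintro ⟨Q, hQ⟩
      exact ⟨Q + b, by rw [smul_add, hQ]; abel⟩
  rw [hiff, exists_eq_smul_sub_iff_norm_eq_zero W hF hPM hgen hfree, smul_add, smul_comm c F]

end Regular

/-! ## §3 McCallum's Lemma 5.3 over `ℚ_ℓ` at `2`: no defect (pure algebra) -/

section Algebra

variable {T : Type*} [AddCommGroup T] (τ : T →+ T) {M : ℕ} {P : T}
  {C : Type*} [AddCommGroup C] (e : T →+ T →+ C)

/-- **McCallum's Lemma 5.3 at `p = 2` over `ℚ_ℓ`, `E`-side — NO DEFECT.** `T` free of rank one over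
`R_M = ℤ/2^M[τ]` on `P` (`τ` an involution, `2^M P = 0`, `T = ℤP + ℤτP` with no smaller relation —
`E[2^M]` on `Δ < 0` with `τ = Frob_ℓ ∼ c₀`), `e` biadditive ALTERNATING and left-non-degenerate (the Weil
pairing). For `u ∈ T` arbitrary (the Frobenius value `[s, F]` of an unramified class, defined modulo
`(τ − 1)T`) and `t` with `τt = −t` (a tame value `[d, σ]`): if `2^a t ≠ 0` and `e(u, t) = 0` then
**`2^{M−1−a}·(u + τu) = 0`**, i.e. `2^{M−1−a} u ∈ (τ − 1)T`. Proof: `t = γ(P − τP)`, `u = xP + yτP`,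
`e(u, t) = −(x + y)γ·e(P, τP)` with `e(P, τP)` of order `2^M`; `2^a t ≠ 0` gives `v₂(γ) ≤ M − 1 − a`,
so `2^{a+1} ∣ x + y`, and `u + τu = (x + y)(P + τP)`. Over `K_λ` the unramified value is `Nu` itself
and `e(Nu, t) = 2e(u, t)` — the lost bit of `Gorenstein.pairing_norm_norm`; over `ℚ_ℓ` there is none.
[cite: McCallumLMS1991, §5 Lemma 5.3] -/
theorem pow_zsmul_norm_eq_zero_of_pairing_eq_zero (hA : ∀ a, τ (τ a) = a) (hM : 1 ≤ M)
    (hPM : (2 : ℤ) ^ M • P = 0) (hgen : ∀ a, ∃ x y : ℤ, a = x • P + y • τ P)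
    (hfree : ∀ x y : ℤ, x • P + y • τ P = 0 → (2 : ℤ) ^ M ∣ x ∧ (2 : ℤ) ^ M ∣ y)
    (halt : ∀ a, e a a = 0) (hnd : ∀ a, (∀ b, e a b = 0) → a = 0)
    {u t : T} (ht : τ t = -t) {a : ℕ} (hat : (2 : ℤ) ^ a • t ≠ 0) (het : e u t = 0) :
    (2 : ℤ) ^ (M - 1 - a) • (u + τ u) = 0 := by
  -- coordinates: `t = γ(P − τP)`, `u = xP + yτP = (x + y)P + y(τP − P)`
  obtain ⟨γ, rfl⟩ := (tau_eq_neg_iff_of_free τ hA hPM hgen hfree t).mp ht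
  obtain ⟨x, y, rfl⟩ := hgen u
  have hτPM : (2 : ℤ) ^ M • τ P = 0 := by rw [← map_zsmul, hPM, map_zero]
  have h2M : ∀ z : T, 2 ^ M • z = 0 := fun z ↦ by
    obtain ⟨x', y', rfl⟩ := hgen z
    rw [← natCast_zsmul, Nat.cast_pow, Nat.cast_ofNat, smul_add, smul_comm _ x', smul_comm _ y', hPM,
      hτPM, smul_zero, smul_zero, add_zero]
  -- `P` has order `2^M` exactly
  have hordP : 2 ^ (M - 1) • P ≠ 0 := by
    intro h0
    rw [← natCast_zsmul, Nat.cast_pow, Nat.cast_ofNat] at h0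
    have := (hfree ((2 : ℤ) ^ (M - 1)) 0 (by rw [zero_smul, add_zero, h0])).1
    have h1 : (2 : ℤ) ^ M ≤ (2 : ℤ) ^ (M - 1) := Int.le_of_dvd (by positivity) this
    have h2 : (2 : ℤ) ^ (M - 1) < (2 : ℤ) ^ M := pow_lt_pow_right₀ (by norm_num) (by omega)
    omega
  -- `{P, P − τP}` is a basis too, so `e(P, P − τP)` has order `2^M`
  have hgen' : ∀ z : T, ∃ β δ : ℤ, z = β • P + δ • (P - τ P) := fun z ↦ by
    obtain ⟨x', y', rfl⟩ := hgen z
    exact ⟨x' + y', -y', by rw [add_smul, neg_smul, smul_sub]; abel⟩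
  have hω : addOrderOf (e P (P - τ P)) = 2 ^ M :=
    KolyvaginEigenPow.addOrderOf_pairing_eq Nat.prime_two hM h2M e halt hnd hgen' hordP
  -- `e(u, t) = e((x + y)P, t)` since `e(τP − P, P − τP) = 0`
  have hskew : ∀ a b, e a b = -e b a := pairing_skew_of_alternating e halt
  have het' : e ((x + y) • P) (γ • (P - τ P)) = 0 := by
    have hsplit : x • P + y • τ P = (x + y) • P + y • (τ P - P) := by
      rw [add_smul, smul_sub]; abel
    have hzero : e (y • (τ P - P)) (γ • (P - τ P)) = 0 := by
      have h1 : τ P - P = -(P - τ P) := by abel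
      rw [h1]
      simp only [smul_neg, map_neg, map_zsmul, AddMonoidHom.neg_apply, AddMonoidHom.zsmul_apply, halt,
        smul_zero, neg_zero]
    rw [hsplit, map_add, AddMonoidHom.add_apply, hzero, add_zero] at het
    exact het
  -- McCallum: `2^{M−1−a}·(x + y)P = 0`
  have hat' : 2 ^ a • (γ • (P - τ P)) ≠ 0 := by
    rwa [← natCast_zsmul, Nat.cast_pow, Nat.cast_ofNat]
  have hkey := KolyvaginEigenPow.pow_nsmul_eq_zero_of_pairing_eq_zero Nat.prime_two h2M e
    (x := (x + y) • P) (y₀ := γ • (P - τ P)) (AddSubgroup.mem_zmultiples_iff.mpr ⟨x + y, rfl⟩)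
    (AddSubgroup.mem_zmultiples_iff.mpr ⟨γ, rfl⟩) hω hat' het'
  -- `u + τu = (x + y)P + τ((x + y)P)`
  have hN : x • P + y • τ P + τ (x • P + y • τ P) = (x + y) • P + τ ((x + y) • P) := by
    rw [map_add, map_zsmul, map_zsmul, hA, map_zsmul, add_smul, add_smul]
    abel
  have hkey' : (2 : ℤ) ^ (M - 1 - a) • ((x + y) • P) = 0 := by
    rw [show (2 : ℤ) ^ (M - 1 - a) = ((2 ^ (M - 1 - a) : ℕ) : ℤ) by push_cast; rfl, natCast_zsmul]
    exact hkey
  rw [hN, smul_add, ← map_zsmul, hkey', map_zero, add_zero]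

end Algebra

/-! ## §4 `2^{M−1−a} x ∈ torsionLocalKer` from the reciprocity value (the `duality` field over `ℚ_ℓ`) -/

section Duality

variable {F : absoluteGaloisGroup K} {M : ℕ} {P : geomTorsion W ((2 ^ M : ℕ) : ℤ)}

/-- **McCallum's Lemma 5.3 with Prop. 2.2 over `ℚ_ℓ` at `p = 2`, torsion-module form — the `duality`
field of the split descent, GIVEN the reciprocity value.** Setting: a finite place `v` with `𝔓` the prime
of `\bar ℤ_K` cut out by the chosen embedding, `F` an arithmetic Frobenius at `𝔓` acting on
`T = E[2^M]` as an involution with `T` free of rank one over `ℤ/2^M[F]` on `P` (over `ℚ`: a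
Gross–Kolyvagin prime of depth `M` on `Δ(E) < 0`), `I_𝔓` fixing `T`, `Γ_{K(T)}` open, `T → E(K̄_v)[2^M]`
onto; `e` an alternating left-non-degenerate biadditive pairing on `T` (the Weil pairing `e_{2^M}`).
If `x ∈ H¹(K, E[2^M])` is unramified at `𝔓` and for some `t ∈ T` with `Ft = −t` (a tame value `[d, σ]`
of a class `d`) one has `2^a t ≠ 0` and the reciprocity value `e([x, F], t) = 0`, then
**`2^{M−1−a}·x ∈ torsionLocalKer`** — i.e. `ord x_v ≤ 2^{M−1−a}`, the printed conclusion of Lemma 5.3,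
with no defect at `2`. [cite: McCallumLMS1991, §5 Lemma 5.3 (with §2 Prop. 2.2)] [cite: GrossLMS1991, Prop. 9.6] -/
theorem pow_zsmul_mem_torsionLocalKer_of_pairing_eq_zero
    {𝔐 : Ideal (HeightOneSpectrum.localAbsIntegers v)} (h𝔐 : 𝔐 ∈ v.localPrimesAbove)
    (hFrob : IsArithFrobAt (𝓞 K) F (v.primeBelow (closureEmb (K := K) (v.adicCompletion K)) 𝔐))
    (hI : (v.primeBelow (closureEmb (K := K) (v.adicCompletion K)) 𝔐).inertia
      (absoluteGaloisGroup K) ≤ torsionFixing W ((2 ^ M : ℕ) : ℤ))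
    (hopen : IsOpen (torsionFixing W ((2 ^ M : ℕ) : ℤ) : Set (absoluteGaloisGroup K)))
    (hsurj : Function.Surjective (torsionPointsMap W (v.adicCompletion K) ((2 ^ M : ℕ) : ℤ)))
    (hF : ∀ Q : geomTorsion W ((2 ^ M : ℕ) : ℤ), F • F • Q = Q) (hM : 1 ≤ M)
    (hPM : (2 : ℤ) ^ M • P = 0)
    (hgen : ∀ Q : geomTorsion W ((2 ^ M : ℕ) : ℤ), ∃ x y : ℤ, Q = x • P + y • F • P)
    (hfree : ∀ x y : ℤ, x • P + y • F • P = 0 → (2 : ℤ) ^ M ∣ x ∧ (2 : ℤ) ^ M ∣ y)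
    {C : Type*} [AddCommGroup C]
    (e : geomTorsion W ((2 ^ M : ℕ) : ℤ) →+ geomTorsion W ((2 ^ M : ℕ) : ℤ) →+ C)
    (halt : ∀ a, e a a = 0) (hnd : ∀ a, (∀ b, e a b = 0) → a = 0)
    {x : galH1Torsion W ((2 ^ M : ℕ) : ℤ)}
    (hx : x ∈ unramifiedKer (geomTorsion W ((2 ^ M : ℕ) : ℤ))
      (v.primeBelow (closureEmb (K := K) (v.adicCompletion K)) 𝔐))
    {t : geomTorsion W ((2 ^ M : ℕ) : ℤ)} (ht : F • t = -t) {a : ℕ} (hat : ((2 : ℤ) ^ a) • t ≠ 0)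
    (het : e (h1Eval W _ x F) t = 0) :
    ((2 : ℤ) ^ (M - 1 - a)) • x ∈ W.torsionLocalKer (v.adicCompletion K) ((2 ^ M : ℕ) : ℤ) := by
  rw [zsmul_mem_torsionLocalKer_iff_norm W h𝔐 hFrob hI hopen hsurj hF hPM hgen hfree hx]
  set τF : geomTorsion W ((2 ^ M : ℕ) : ℤ) →+ geomTorsion W ((2 ^ M : ℕ) : ℤ) :=
    DistribSMul.toAddMonoidHom (geomTorsion W ((2 ^ M : ℕ) : ℤ)) F with hτF
  have hτFa : ∀ a, τF a = F • a := fun a ↦ rfl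
  have hA : ∀ a, τF (τF a) = a := fun a ↦ by rw [hτFa, hτFa]; exact hF a
  have hgen' : ∀ a, ∃ x y : ℤ, a = x • P + y • τF P := fun a ↦ by rw [hτFa]; exact hgen a
  have hfree' : ∀ x y : ℤ, x • P + y • τF P = 0 → (2 : ℤ) ^ M ∣ x ∧ (2 : ℤ) ^ M ∣ y :=
    fun x y h ↦ hfree x y (by rw [hτFa] at h; exact h)
  have ht' : τF t = -t := by rw [hτFa]; exact ht
  have h := pow_zsmul_norm_eq_zero_of_pairing_eq_zero τF e hA hM hPM hgen' hfree' halt hnd ht' hat het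
  rw [hτFa] at h
  exact h

end Duality

end Summit.BirchSwinnertonDyer.BirchSwinnertonDyer.Theorems.GenusExact.FrobeniusCriterion

end
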